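import Summits.HodgeConjecture.CorCM.MumfordTateRankSix
import Literature.Algebra.Lie.SemisimpleDimensionThreeSimple
import HarnessLib

/-!
# For a non-CM complex abelian variety with `dim MT(H¹X) ≤ 6` the semisimple part `[Lie Hg, Lie Hg]` is a SIMPLE Lie algebra
# of dimension `3`

COR-CM (cell `pub-hodgecm2`, seat `b27` gen 36, count-neutral lane MT-REDUCTIVE; theorems only, no definition, no named fact;
UNCONDITIONAL — nothing here uses or asserts HC_CM).  Sequel of `CorCM/MumfordTateRankSix` (`dim [Lie Hg, Lie Hg] = 3` on the rungs
`t = 4, 5, 6`) with the Lie lemma `SemisimpleSmallDimension.isSimple_of_finrank_lt_six` (a semisimple Lie algebra of dimension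
`< 6` is simple).

* **`isSimple_of_eq_hodgeLie_hodge_one_derived_of_finrank_lt_six`** — `X` not CM and `dim [Lie Hg, Lie Hg] < 6` ⟹ every Lie
  subalgebra of `𝔤𝔩(H¹X)` with carrier `[Lie Hg, Lie Hg]` is SIMPLE (`LieAlgebra.IsSimple ℚ`) of dimension `3`;
* **`isSimple_of_eq_hodgeLie_hodge_one_derived_of_mtRank_le_six`** — in particular for `X` not CM with `dim MT(H¹X) ≤ 6`
  (rungs `t = 4, 5, 6`: `Hg` is «`SL₂`-like times a torus of dimension `t - 4`»).

## References
* [MoonenZarhin1999LowDim] B. Moonen, Yu. Zarhin, Math. Ann. 315 (1999), §2.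
* [Humphreys1972] J. E. Humphreys, GTM 9, §5.2, §8.4.
-/

noncomputable section

open CategoryTheory CategoryTheory.Limits Module
open scoped BigOperators

namespace Summit.HodgeConjecture.CorCM

open Literature.AlgebraicGeometry.Motives
open Literature.AlgebraicGeometry.Motives.AbelianVariety
open Literature.AlgebraicGeometry.Motives.HodgeStructure
open Literature.AlgebraicGeometry.HodgeTheory
open Literature.AlgebraicGeometry.Milne1999 (IsOfCMType)

variable [HodgeTensorFacts.{0, 0}] {X : AbelianVariety ℂ} {n : ℕ}

/-- **`X` not of CM type and `dim [Lie Hg(H¹X), Lie Hg(H¹X)] < 6` ⟹ `[Lie Hg, Lie Hg]` is a SIMPLE Lie algebra of dimension `3`**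
(for every Lie subalgebra `𝔏 ≤ 𝔤𝔩(H¹X)`, commutator bracket, with carrier `[Lie Hg, Lie Hg]`: `LieAlgebra.IsSimple ℚ 𝔏` and
`dim 𝔏 = 3`). [cite: MoonenZarhin1999LowDim, §2] [cite: Humphreys1972, §5.2] -/
theorem isSimple_of_eq_hodgeLie_hodge_one_derived_of_finrank_lt_six (hX : IsSmoothProjective n X.X) (hcm : ¬ IsOfCMType X)
    (h6 : haveI := BettiUniverse.finite hX 1
      Module.finrank ℚ ↥(Submodule.span ℚ {B | ∃ X' ∈ (BettiUniverse.hodge exists_isReal_hodgeModel_holds hX 1).hodgeLie,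
        ∃ Y ∈ (BettiUniverse.hodge exists_isReal_hodgeModel_holds hX 1).hodgeLie, X' * Y - Y * X' = B}) < 6) :
    haveI := BettiUniverse.finite hX 1
    letI : LieRing (Module.End ℚ (bettiCohomology X.X 1)) := LieRing.ofAssociativeRing
    ∀ 𝔏 : LieSubalgebra ℚ (Module.End ℚ (bettiCohomology X.X 1)),
      𝔏.toSubmodule = Submodule.span ℚ {B | ∃ X' ∈ (BettiUniverse.hodge exists_isReal_hodgeModel_holds hX 1).hodgeLie,
        ∃ Y ∈ (BettiUniverse.hodge exists_isReal_hodgeModel_holds hX 1).hodgeLie, X' * Y - Y * X' = B} →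
      LieAlgebra.IsSimple ℚ 𝔏 ∧ Module.finrank ℚ 𝔏 = 3 := by
  haveI := BettiUniverse.finite hX 1
  letI : LieRing (Module.End ℚ (bettiCohomology X.X 1)) := LieRing.ofAssociativeRing
  intro 𝔏 h𝔏
  haveI := (isSemisimple_of_eq_hodgeLie_hodge_one_derived hX 𝔏 h𝔏).1
  haveI : Module.Finite ℚ 𝔏 := Module.Finite.of_injective 𝔏.toSubmodule.subtype Subtype.val_injective
  have e : Module.finrank ℚ 𝔏 = Module.finrank ℚ 𝔏.toSubmodule := rfl
  have h3 := (three_le_finrank_hodgeLie_hodge_one_derived hX hcm).1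
  have h0 : 0 < Module.finrank ℚ 𝔏 := by rw [e, h𝔏]; omega
  have h6' : Module.finrank ℚ 𝔏 < 6 := by rw [e, h𝔏]; exact h6
  exact ⟨Literature.Algebra.Lie.SemisimpleSmallDimension.isSimple_of_finrank_lt_six h0 h6',
    Literature.Algebra.Lie.SemisimpleSmallDimension.finrank_eq_three_of_finrank_lt_six h0 h6'⟩

/-- **Rungs `t = 4, 5, 6` (non-CM): `[Lie Hg(H¹X), Lie Hg(H¹X)]` is a SIMPLE three-dimensional Lie algebra** (a `ℚ`-form of `𝔰𝔩₂`;
Moonen–Zarhin's `SL₂`, `SL₂ · U(1)` shapes and the new rung `t = 6`): for `X` not of CM type with `0 < dim X` and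
`dim MT(H¹X) ≤ 6`, every Lie subalgebra of `𝔤𝔩(H¹X)` with carrier `[Lie Hg, Lie Hg]` is simple of dimension `3`.
[cite: MoonenZarhin1999LowDim, §2] [cite: Humphreys1972, §5.2] -/
theorem isSimple_of_eq_hodgeLie_hodge_one_derived_of_mtRank_le_six (hX : IsSmoothProjective n X.X) (h0 : 0 < X.dim)
    (hcm : ¬ IsOfCMType X)
    (h6 : haveI := BettiUniverse.finite hX 1
      (BettiUniverse.hodge exists_isReal_hodgeModel_holds hX 1).mtRank ≤ 6) :
    haveI := BettiUniverse.finite hX 1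
    letI : LieRing (Module.End ℚ (bettiCohomology X.X 1)) := LieRing.ofAssociativeRing
    ∀ 𝔏 : LieSubalgebra ℚ (Module.End ℚ (bettiCohomology X.X 1)),
      𝔏.toSubmodule = Submodule.span ℚ {B | ∃ X' ∈ (BettiUniverse.hodge exists_isReal_hodgeModel_holds hX 1).hodgeLie,
        ∃ Y ∈ (BettiUniverse.hodge exists_isReal_hodgeModel_holds hX 1).hodgeLie, X' * Y - Y * X' = B} →
      LieAlgebra.IsSimple ℚ 𝔏 ∧ Module.finrank ℚ 𝔏 = 3 := by
  haveI := BettiUniverse.finite hX 1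
  obtain ⟨h1, -, -, -, -⟩ := mtRank_hodge_one_shape hX h0 hcm
  refine isSimple_of_eq_hodgeLie_hodge_one_derived_of_finrank_lt_six hX hcm ?_
  omega

end Summit.HodgeConjecture.CorCM

end
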